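import Mathlib
import Summits.Ventures.PercRepro2.KPrimeRootLeafA1
import Summits.Ventures.PercRepro2.KPrimeRootLeafExt

/-!
# The root `a₁` on a leaf: transport to a leaf extension, and the rotation of the mass vectors on
the `5`-cycle (blind cell PercRepro2, mine-c g42; `conjectures/MINE-C.md` §51.4)

`isoMassesA₁_transport'` / `isoMassesA₁_leafExt` (as for `isoMasses`), `kprime_leafExt_a₁`
(`(K′)` on `leafExt ends z` with `a₁` the leaf from `(K′)` on `ends` at `z` and the two mixed
root-leaf coefficients evaluated on `ends`), and the ROTATION of the mass vectors on `cycN 5`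
(`kmasses_shift5`, `isoMassesA₁_shift5`: the vectors at the marks shifted by `k` under the rotated
weights `w ∘ shiftEquiv k` are the vectors at the original marks), which lets the certificates
with the `z`-instance's `a₁` at `0` serve every placement.
-/

namespace Summit.Ventures.PercRepro2

namespace KPrimeCycle

open Cycle

section Transport

variable {V : Type*} {V' : Type*} {E : Type*} {E' : Type*} [Fintype E] [DecidableEq E]
  [Fintype E'] [DecidableEq E'] [DecidableEq V] [DecidableEq V'] {R : Type*} [Field R]

omit [DecidableEq V] [DecidableEq V'] in
/-- Transport of the isolated-`a₁` mass vector across types. -/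
theorem isoMassesA₁_transport' {q : E → R} {p : E' → R} {ends : E → Sym2 V}
    {ends' : E' → Sym2 V'} {Ψ : Config E' → Config E} {φ : V → V'}
    (hP : ∀ A : Set (Config E), prob q A = prob p (Ψ ⁻¹' A))
    (hH : ∀ ω x z, Conn ends (Ψ ω) x z ↔ Conn ends' ω (φ x) (φ z)) (a₂ v y : V) :
    KPrime.isoMassesA₁ ends a₂ v y q = KPrime.isoMassesA₁ ends' (φ a₂) (φ v) (φ y) p := by
  funext k
  fin_cases k <;>
  simp only [KPrime.isoMassesA₁, hP, Set.preimage_inter, preimage_connEvent' hH,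
    preimage_avoidAll_singleton' hH]

end Transport

section LeafExt

variable {V : Type*} {E : Type*} [Fintype E] [DecidableEq E] [Fintype V] [DecidableEq V]
  {R : Type*} [Field R] [LinearOrder R] [IsStrictOrderedRing R]

omit [Fintype V] [DecidableEq V] [LinearOrder R] [IsStrictOrderedRing R] in
/-- The isolated-`a₁` mass vector of the leaf extension at old marks is that of the old graph. -/
theorem isoMassesA₁_leafExt (ends : E → Sym2 V) (z : V) (p : E ⊕ Unit → R) (a₂ v y : V) :
    KPrime.isoMassesA₁ (leafExt ends z) (Sum.inl a₂) (Sum.inl v) (Sum.inl y) p =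
      KPrime.isoMassesA₁ ends a₂ v y (p ∘ Sum.inl) :=
  (isoMassesA₁_transport' (fun A => prob_comp_inl p A)
    (fun ω x x' => conn_leafExt_iff ends z ω x x') a₂ v y).symm

omit [Fintype V] in
/-- **The root `a₁` on a leaf of `ends` at `z`**: `(K′)` on the leaf extension with `a₁` the leaf,
from `(K′)` on `ends` at `(z, a₂, b, v, y)` and the two mixed root-leaf coefficients evaluated on
`ends` with the old weights. -/
theorem kprime_leafExt_a₁ (ends : E → Sym2 V) (z a₂ b v y : V) (p : E ⊕ Unit → R)
    (hp : IsProbVec p) (he : p (Sum.inr ()) ≠ 1)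
    (hG₁ : 0 ≤ KPrime.mixedOne (KPrime.isoMassesA₁ ends a₂ v y (p ∘ Sum.inl))
      (KPrime.kmasses ends z a₂ b v y (p ∘ Sum.inl)))
    (hG₂ : 0 ≤ KPrime.mixedTwo (KPrime.isoMassesA₁ ends a₂ v y (p ∘ Sum.inl))
      (KPrime.kmasses ends z a₂ b v y (p ∘ Sum.inl)))
    (hF₁ : KPrime.KPrimeHolds ends z a₂ b v y (p ∘ Sum.inl)) :
    KPrime.KPrimeHolds (leafExt ends z) (Sum.inr ()) (Sum.inl a₂) (Sum.inl b) (Sum.inl v)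
      (Sum.inl y) p := by
  refine KPrime.kprime_of_rootLeaf_a₁ hp (leafExt_leaf ends z) (by rw [leafExt_inr, Sym2.eq_swap])
    Sum.inl_ne_inr Sum.inl_ne_inr Sum.inl_ne_inr Sum.inl_ne_inr Sum.inl_ne_inr he ?_ ?_ ?_
  · rwa [isoMassesA₁_leafExt, kmasses_leafExt, update_inr_comp_inl]
  · rwa [isoMassesA₁_leafExt, kmasses_leafExt, update_inr_comp_inl]
  · rwa [← kprimeHolds_leafExt, update_inr_comp_inl]

end LeafExt

section Rotate

variable {R : Type*} [Field R]

/-- The rotation of the `5`-cycle by `k` as a transport datum: the law. -/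
lemma prob_shift5 (w : Fin 5 → R) (k : Fin 5) (A : Set (Config (Fin 5))) :
    prob w A = prob (w ∘ shiftEquiv k) ((fun ω : Config (Fin 5) => fun i => ω (i - k)) ⁻¹' A) := by
  have h := prob_comp_equiv (shiftEquiv k).symm (w ∘ shiftEquiv k) A
  have hw : (w ∘ shiftEquiv k) ∘ (shiftEquiv k).symm = w := by
    ext i
    simp [Function.comp, shiftEquiv, sub_add_cancel]
  rw [hw] at h
  exact h

/-- **Rotating the mass vector** of the `5`-cycle: the vector at the marks, under `w`, is the vector
at the marks shifted by `−k`, under `w ∘ shiftEquiv k`. -/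
theorem kmasses_shift5 (w : Fin 5 → R) (k a₁ a₂ b v y : Fin 5) :
    KPrime.kmasses (cycN 5) a₁ a₂ b v y w =
      KPrime.kmasses (cycN 5) (a₁ - k) (a₂ - k) (b - k) (v - k) (y - k) (w ∘ shiftEquiv k) :=
  kmasses_transport' (prob_shift5 w k) (fun ω x z => conn_cycN_shift ω k x z) a₁ a₂ b v y

/-- **Rotating the isolated-`a₁` mass vector** of the `5`-cycle. -/
theorem isoMassesA₁_shift5 (w : Fin 5 → R) (k a₂ v y : Fin 5) :
    KPrime.isoMassesA₁ (cycN 5) a₂ v y w =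
      KPrime.isoMassesA₁ (cycN 5) (a₂ - k) (v - k) (y - k) (w ∘ shiftEquiv k) :=
  isoMassesA₁_transport' (prob_shift5 w k) (fun ω x z => conn_cycN_shift ω k x z) a₂ v y

end Rotate

end KPrimeCycle

end Summit.Ventures.PercRepro2
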